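import Summits.ResolutionOfSingularities.ResolutionOfSingularities.Theorems.FrobeniusClosingPatchingRelPerfectPointBlowupChartAssembly
import Literature.AlgebraicGeometry.Resolution.QuasiRegularSequences
import Literature.AlgebraicGeometry.Resolution.MvPolynomialKillVars
import HarnessLib

/-!
# Crux `PatchingRelPerfect` (stmt-ResolutionOfSingularities-16161), chain w52 — CORE RUNG r1τ,
# part 1: the REGULAR-CENTRE TOWER over the Rees charts (ring level, any regular ring)

[OURS · L1 W5.2 · rung r1τ] Chart-level heart of rung r1τ of the blow-up-form open core
`stub_atomDimFourBlowup` (`AtomDimFourBlowupAt`, skeleton v5.1): the family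
`K = (z₁, …, z_m) + 𝔪ᵈ`, `z` part of a regular system of parameters, for EVERY `d` (rung r1c of
`…CoreRungSquarePlusLinear.lean` is `d = 2`; CHAIN.md v1.2 §3 records the `d ≥ 3` tower as the
missing piece behind the monomial complete intersections with exponents in `{1, d}`).  The
companion of `K` is `Q = 𝔪 · (z + 𝔪²) ⋯ (z + 𝔪ᵈ⁻¹)`, i.e. `Bl_{K·Q} = Bl_{𝔪 (z+𝔪²) ⋯ (z+𝔪ᵈ)}`
is the point blow-up followed by `d − 1` blowing ups of the REGULAR codimension-`(m+1)` centres
`L_k ∩ E_k` (`L_k` the strict transform of `L = V(z)`, `E_k` the newest exceptional divisor).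
Since after the first blowing up the base is no longer local, the induction has to run at RING
LEVEL over an arbitrary regular ring; this file proves it there, the local rung and its
corollaries are assembled in `…CoreRungTower.lean`.  PROVED (no sorry, standard axioms):

* `isRegular_of_isBlowup_tower` — **the tower theorem**: `R` a regular ring, `x = (x₁, …, x_n)`
  quasi-regular with `R/(x)` regular, `ι : Fin a ↪ Fin n`, `P = (x_{ι k})_k`, `M = (x)`: for
  every `N`, every blowing up of `Spec R` along `∏_{k<N} (P + Mᵏ⁺¹) = M (P + M²) ⋯ (P + Mᴺ)` is
  regular.  Induction on `N` over the Rees charts `D₊(x_i t) = Spec B_i` of `Bl_M`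
  (stub-4's chartwise assembly `isRegular_of_isBlowup_mul_of_charts`): on the chart of a killed
  direction `x_{ι j}` the tail `∏_{k<N} (P + Mᵏ⁺²)` becomes the Cartier divisor `(x_{ι j}ᴺ)`
  (`map_chartBase_prod`, `span_chartGen_eq_top_of_eq`); on any other chart it becomes
  `(x_iᴺ) · ∏_{k<N} (P' + M'ᵏ⁺¹)` for the CHART FAMILY `x' = (x_i, e_{ι 1}, …, e_{ι a})`,
  `e_j = x_j/x_i`, which is again quasi-regular with regular quotient in the regular ring `B_i`;
* the chart family facts, proved for ABSTRACT chart data `(A, t, u, ε : Λ[T_σ] ≅ A/(t))` to keep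
  instance search light and then specialised (`isWeaklyRegular_cons_of_quotEquiv`,
  `isRegularRing_quot_cons_of_quotEquiv`; `isWeaklyRegular_chartFamily`,
  `isQuasiRegular_chartFamily`, `isRegularRing_quot_chartFamily`): `x_i/1` is a
  non-zero-divisor (Stacks 0804), modulo `x_i` the `e_{ι k}` are distinct variables of
  `B_i/(x_i) ≅ (R/M)[T_j : j ≠ i]` (`chartQuotEquiv`, Stacks 0BIQ), hence a weakly regular
  sequence (tree `MvPolynomial.isWeaklyRegular_map_X`), hence quasi-regular (Rees); and
  `B_i/(x_i, e_ι) ≅ (R/M)[T_j : j ∉ ι]` is a polynomial ring over the regular ring `R/M`;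
* the ideal algebra of the tower (`CoreRungTower.*`) and the twisting-off step
  `isRegular_of_isBlowup_span_singleton_mul` (Stacks 080B).

Arbitrary (regular) commutative rings throughout; no dimension, characteristic, completeness or
residue-field hypothesis.  FORMAT evidence for the core only (CHAIN §1 (A)); nothing here is a
statement of the manuscript under review.

## References

* Q. Liu, *Algebraic Geometry and Arithmetic Curves*, OUP 2002, Thm. 8.1.19 (a). [Liu2002]
* The Stacks Project, Tags 080A, 080B, 0804, 0BIQ. [StacksProject]
* H. Matsumura, *Commutative Ring Theory*, CUP 1986, Thm. 16.2 (i). [Matsumura1987]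
-/

-- `Summit.<Summit>.<Sub>.Theorems` with `Sub = Summit` (single-conjunct summit, D-0017)
set_option linter.dupNamespace false

noncomputable section

open CategoryTheory CategoryTheory.Limits AlgebraicGeometry Literature.AlgebraicGeometry.Resolution
open scoped Pointwise

namespace Summit.ResolutionOfSingularities.ResolutionOfSingularities.Theorems

universe u

/-! ## Algebra of the tower ideals `∏_{k<N} (P + Mᵏ⁺¹)` -/

namespace CoreRungTower

/-- `Ideal.map` commutes with finite products over `Finset.range`. [folklore] -/
theorem map_prod_range {R S : Type*} [CommSemiring R] [CommSemiring S] (f : R →+* S)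
    (F : ℕ → Ideal R) (N : ℕ) :
    (∏ k ∈ Finset.range N, F k).map f = ∏ k ∈ Finset.range N, (F k).map f := by
  induction N with
  | zero =>
    rw [Finset.prod_range_zero, Finset.prod_range_zero, Ideal.one_eq_top, Ideal.one_eq_top,
      Ideal.map_top]
  | succ N ih => rw [Finset.prod_range_succ, Finset.prod_range_succ, Ideal.map_mul, ih]

/-- Binomial estimate: `(𝔞 + Y)ᵈ ⊆ 𝔞 + Yᵈ`. [folklore] -/
theorem sup_pow_le {R : Type*} [CommSemiring R] (𝔞 Y : Ideal R) (d : ℕ) :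
    (𝔞 ⊔ Y) ^ d ≤ 𝔞 ⊔ Y ^ d := by
  induction d with
  | zero => rw [pow_zero, pow_zero, Ideal.one_eq_top]; exact le_sup_right
  | succ d ih =>
    rw [pow_succ, pow_succ]
    refine (Ideal.mul_mono_left ih).trans ?_
    rw [Ideal.sup_mul, Ideal.mul_sup, Ideal.mul_sup]
    refine sup_le (sup_le ?_ ?_) (sup_le ?_ ?_)
    · exact le_sup_of_le_left Ideal.mul_le_right
    · exact le_sup_of_le_left Ideal.mul_le_right
    · exact le_sup_of_le_left Ideal.mul_le_left
    · exact le_sup_right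

/-- `𝔞 + Yᵈ = 𝔞 + (𝔞 + Y)ᵈ`: modulo `𝔞`, the `d`-th power of `𝔞 + Y` is that of `Y`. [folklore] -/
theorem sup_pow_eq_sup_sup_pow {R : Type*} [CommSemiring R] (𝔞 Y : Ideal R) (d : ℕ) :
    𝔞 ⊔ Y ^ d = 𝔞 ⊔ (𝔞 ⊔ Y) ^ d :=
  le_antisymm (sup_le_sup_left (Ideal.pow_right_mono le_sup_right d) 𝔞)
    (sup_le le_sup_left (sup_pow_le 𝔞 Y d))

/-- If `M = P + (t)` then `P + Mᵏ = P + (tᵏ)`. [folklore] -/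
theorem sup_pow_eq_sup_span_singleton_pow {R : Type*} [CommSemiring R] {P M : Ideal R} {t : R}
    (hM : M = P ⊔ Ideal.span {t}) (k : ℕ) :
    P ⊔ M ^ k = P ⊔ Ideal.span {t ^ k} := by
  rw [hM, ← sup_pow_eq_sup_sup_pow, Ideal.span_singleton_pow]

/-- A lower bound for a product of ideals each containing `Mᵇ`: `M^{N b} ⊆ ∏_{k<N} F_k`.
[folklore] -/
theorem pow_mul_le_prod_range {R : Type*} [CommSemiring R] (M : Ideal R) (F : ℕ → Ideal R)
    (b N : ℕ) (h : ∀ k, k < N → M ^ b ≤ F k) :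
    M ^ (N * b) ≤ ∏ k ∈ Finset.range N, F k := by
  induction N with
  | zero => rw [zero_mul, pow_zero, Finset.prod_range_zero]
  | succ N ih =>
    rw [Finset.prod_range_succ, Nat.succ_mul, pow_add]
    exact Ideal.mul_mono (ih fun k hk => h k (Nat.lt_succ_of_lt hk)) (h N (Nat.lt_succ_self N))

/-- Peeling off the first factor of the tower ideal: for `P ⊆ M`,
`∏_{k<N+1} (P + Mᵏ⁺¹) = (∏_{k<N} (P + Mᵏ⁺²)) · M`. [folklore] -/
theorem prod_range_succ_eq_mul {R : Type*} [CommSemiring R] {P M : Ideal R} (hPM : P ≤ M)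
    (N : ℕ) :
    ∏ k ∈ Finset.range (N + 1), (P ⊔ M ^ (k + 1)) =
      (∏ k ∈ Finset.range N, (P ⊔ M ^ (k + 1 + 1))) * M := by
  rw [Finset.prod_range_succ' (fun k => P ⊔ M ^ (k + 1)) N, zero_add, pow_one, sup_eq_right.mpr hPM]

end CoreRungTower

open CoreRungTower

/-! ## The tower ideals on the Rees charts of `Bl_M Spec R`, `M = (x₁, …, x_n)` -/

section ChartImages

variable {R : Type u} [CommRing R] {n a : ℕ} (x : Fin n → R) (ι : Fin a → Fin n) (i : Fin n)

/-- **The killed sub-family on a chart**: `(x_{ι 1}, …, x_{ι a}) · B_i = (x_i) · (e_{ι 1}, …, e_{ι a})`,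
`e_j = x_j / x_i` the chart generators. [cite: StacksProject, Tag 0804] -/
theorem CoreRungTower.map_chartBase_span_comp :
    (Ideal.span (Set.range (x ∘ ι))).map (chartBase x i) =
      Ideal.span {chartBase x i (x i)} * Ideal.span (Set.range fun k => chartGen x i (ι k)) := by
  apply le_antisymm
  · rw [Ideal.map_span, Ideal.span_le]
    rintro _ ⟨_, ⟨k, rfl⟩, rfl⟩
    rw [SetLike.mem_coe, Function.comp_apply, reesChartBase_apply_eq_mul_chartGen x i (ι k)]
    exact Ideal.mul_mem_mul (Ideal.mem_span_singleton_self _) (Ideal.subset_span ⟨k, rfl⟩)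
  · rw [Ideal.span_mul_span', Ideal.span_le]
    rintro _ ⟨b, hb, s, hs, rfl⟩
    rw [Set.mem_singleton_iff] at hb
    subst hb
    obtain ⟨k, rfl⟩ := hs
    show chartBase x i (x i) * chartGen x i (ι k) ∈ _
    rw [← reesChartBase_apply_eq_mul_chartGen x i (ι k)]
    exact Ideal.mem_map_of_mem _ (Ideal.subset_span ⟨k, rfl⟩)

/-- **A tower factor on a chart**: `(P + Mᵏ⁺¹) · B_i = (x_i) · (P' + (x_iᵏ))`, where
`P = (x_{ι k})_k`, `M = (x)`, `P' = (e_{ι k})_k`. [cite: StacksProject, Tag 0804] -/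
theorem CoreRungTower.map_chartBase_sup_pow (k : ℕ) :
    (Ideal.span (Set.range (x ∘ ι)) ⊔ Ideal.span (Set.range x) ^ (k + 1)).map (chartBase x i) =
      Ideal.span {chartBase x i (x i)} *
        (Ideal.span (Set.range fun k => chartGen x i (ι k)) ⊔
          Ideal.span {chartBase x i (x i) ^ k}) := by
  rw [Ideal.map_sup, CoreRungTower.map_chartBase_span_comp, Ideal.map_pow,
    map_reesChartBase_eq (x i) (Ideal.mem_span_range_self (f := x) (x := i)),
    Ideal.span_singleton_pow, pow_succ', ← Ideal.span_singleton_mul_span_singleton,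
    ← Ideal.mul_sup]

/-- **The tail of the tower on a chart**: `(∏_{k<N} (P + Mᵏ⁺²)) · B_i = (x_iᴺ) · ∏_{k<N} (P' + (x_iᵏ⁺¹))`
— the same tower one level down, twisted by the exceptional divisor. [cite: StacksProject, Tag 0804] -/
theorem CoreRungTower.map_chartBase_prod (N : ℕ) :
    (∏ k ∈ Finset.range N,
      (Ideal.span (Set.range (x ∘ ι)) ⊔ Ideal.span (Set.range x) ^ (k + 1 + 1))).map
        (chartBase x i) =
      Ideal.span {chartBase x i (x i) ^ N} *
        ∏ k ∈ Finset.range N, (Ideal.span (Set.range fun k => chartGen x i (ι k)) ⊔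
          Ideal.span {chartBase x i (x i) ^ (k + 1)}) := by
  rw [map_prod_range]
  simp_rw [CoreRungTower.map_chartBase_sup_pow x ι i]
  rw [Finset.prod_mul_distrib, Finset.prod_const, Finset.card_range, Ideal.span_singleton_pow]

/-- On the chart of a killed direction `x_i = x_{ι j}` the generator `e_{ι j} = e_i = 1`, so
`P' = B_i`. [folklore] -/
theorem CoreRungTower.span_chartGen_eq_top_of_eq (j : Fin a) (hij : ι j = i) :
    Ideal.span (Set.range fun k => chartGen x i (ι k)) = ⊤ := by
  rw [Ideal.eq_top_iff_one]
  have h1 : chartGen x i (ι j) = 1 := by rw [hij]; exact chartGen_self x i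
  rw [← h1]
  exact Ideal.subset_span ⟨j, rfl⟩

end ChartImages

/-! ## The chart family `(x_i, e_{ι 1}, …, e_{ι a})` is quasi-regular with regular quotient -/

section AbstractChart

/-! Abstract chart data `(A, t, u, ε : Λ[T_σ] ≅ A/(t), ε(T_{jJ k}) = u_k)` (as in
`BlowupChartRsop.lean`, to keep instance search light); specialised to the Rees chart below. -/

variable {A : Type u} [CommRing A] {Λ : Type u} [CommRing Λ] {σ : Type} {a : ℕ}
  (t : A) (u : Fin a → A) (jJ : Fin a → σ)
  (ε : MvPolynomial σ Λ ≃+* A ⧸ Ideal.span {t})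
  (hε : ∀ k, ε (MvPolynomial.X (jJ k)) = Ideal.Quotient.mk (Ideal.span {t}) (u k))

include hε in
/-- **Abstract chart family is weakly regular**: `t` is a non-zero-divisor and, modulo `t`, the
`u_k` are distinct variables of a polynomial ring. [cite: StacksProject, Tag 0BIQ] -/
theorem CoreRungTower.isWeaklyRegular_cons_of_quotEquiv (ht : t ∈ nonZeroDivisors A)
    (hjJ : Function.Injective jJ) :
    RingTheory.Sequence.IsWeaklyRegular A (List.ofFn (Fin.cons t u)) := by
  rw [List.ofFn_succ, Fin.cons_zero, RingTheory.Sequence.isWeaklyRegular_cons_iff]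
  simp only [Fin.cons_succ]
  constructor
  · exact Module.Flat.isSMulRegular_of_nonZeroDivisors ht
  · -- the variables `T_{jJ k}` are a weakly regular sequence on `Λ[T]`
    have hP := MvPolynomial.isWeaklyRegular_map_X (R := Λ) (List.ofFn jJ) (List.nodup_ofFn.mpr hjJ)
    have hBK : RingTheory.Sequence.IsWeaklyRegular (A ⧸ Ideal.span {t})
        (((List.ofFn jJ).map MvPolynomial.X).map ε) :=
      (RingEquiv.isWeaklyRegular_map_iff ε _).mpr hP
    rw [List.map_ofFn, List.map_ofFn] at hBK
    have hfun : ⇑(algebraMap A (A ⧸ Ideal.span {t})) ∘ u = ⇑ε ∘ MvPolynomial.X ∘ jJ :=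
      funext fun k => by rw [Function.comp_apply, Function.comp_apply, Function.comp_apply, hε]; rfl
    have hBK' : RingTheory.Sequence.IsWeaklyRegular (A ⧸ Ideal.span {t}) (List.ofFn u) := by
      rw [← RingTheory.Sequence.isWeaklyRegular_map_algebraMap_iff (A ⧸ Ideal.span {t}),
        List.map_ofFn, hfun]
      exact hBK
    have hKsm : (t • ⊤ : Submodule A A) = (Ideal.span {t}).restrictScalars A := by
      rw [← Submodule.ideal_span_singleton_smul, smul_eq_mul, Ideal.mul_top]
      rfl
    let eq : QuotSMulTop t A ≃ₗ[A] A ⧸ Ideal.span {t} := Submodule.quotEquivOfEq _ _ hKsm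
    exact (eq.isWeaklyRegular_congr _).mpr hBK'

include hε in
/-- **Abstract quotient by the chart family is a regular ring** when `Λ` is:
`A/(t, u) ≅ Λ[T_σ]/(T_{jJ}) ≅ Λ[T_j : j ∉ jJ]`, a polynomial ring over a regular ring (Mathlib
`MvPolynomial.isRegularRing_of_isRegularRing`). [cite: StacksProject, Tag 0BIQ] -/
theorem CoreRungTower.isRegularRing_quot_cons_of_quotEquiv [Finite σ] [IsRegularRing Λ] :
    IsRegularRing (A ⧸ Ideal.span (Set.range (Fin.cons t u))) := by
  classical
  have hsplit : Ideal.span (Set.range (Fin.cons t u)) =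
      Ideal.span {t} ⊔ Ideal.span (Set.range u) := by
    rw [Fin.range_cons, Ideal.span_insert]
  have e1 : A ⧸ Ideal.span (Set.range (Fin.cons t u)) ≃+*
      A ⧸ (Ideal.span {t} ⊔ Ideal.span (Set.range u)) := Ideal.quotEquivOfEq hsplit
  have e2 : A ⧸ (Ideal.span {t} ⊔ Ideal.span (Set.range u)) ≃+*
      (A ⧸ Ideal.span {t}) ⧸ (Ideal.span (Set.range u)).map (Ideal.Quotient.mk (Ideal.span {t})) :=
    (DoubleQuot.quotQuotEquivQuotSup _ _).symm
  have e3 : (A ⧸ Ideal.span {t}) ⧸ (Ideal.span (Set.range u)).map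
      (Ideal.Quotient.mk (Ideal.span {t})) ≃+*
      MvPolynomial σ Λ ⧸ Ideal.span (MvPolynomial.X '' Set.range jJ : Set (MvPolynomial σ Λ)) := by
    refine (Ideal.quotientEquiv (Ideal.span (MvPolynomial.X '' Set.range jJ : Set (MvPolynomial σ Λ)))
      ((Ideal.span (Set.range u)).map (Ideal.Quotient.mk (Ideal.span {t}))) ε ?_).symm
    have hfun : ⇑(Ideal.Quotient.mk (Ideal.span {t})) ∘ u = ⇑ε ∘ MvPolynomial.X ∘ jJ :=
      funext fun k => by rw [Function.comp_apply, Function.comp_apply, Function.comp_apply, hε]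
    rw [Ideal.map_span, Ideal.map_span, ← Set.range_comp, ← Set.range_comp, ← Set.range_comp,
      hfun]
    rfl
  have e4 := (MvPolynomial.quotientSpanXEquiv (R := Λ) (Set.range jJ)).toRingEquiv
  haveI : IsRegularRing (MvPolynomial {j : σ // j ∉ Set.range jJ} Λ) :=
    MvPolynomial.isRegularRing_of_isRegularRing _
  exact IsRegularRing.of_ringEquiv (e1.trans (e2.trans (e3.trans e4))).symm

end AbstractChart

section ChartData

variable {R : Type u} [CommRing R] {n a : ℕ} (x : Fin n → R) (i : Fin n)
  (jJ : Fin a → {j : Fin n // j ≠ i})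

/-- **The chart family `(x_i, e_{jJ 1}, …, e_{jJ a})` is a weakly regular sequence on the chart
ring** `B_i = (R[Mt])_{(x_i t)}` (for `x` quasi-regular and `jJ` injective): `x_i/1` is a
non-zero-divisor (Stacks 0804) and modulo `x_i` the `e_{jJ k}` are distinct variables of
`B_i/(x_i) ≅ (R/M)[T_j : j ≠ i]` (`chartQuotEquiv`). [cite: StacksProject, Tag 0BIQ] -/
theorem CoreRungTower.isWeaklyRegular_chartFamily (hx : IsQuasiRegular x)
    (hjJ : Function.Injective jJ) :
    RingTheory.Sequence.IsWeaklyRegular (chartRing x i)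
      (List.ofFn (Fin.cons (chartBase x i (x i)) fun k => chartGen x i (jJ k).1)) :=
  CoreRungTower.isWeaklyRegular_cons_of_quotEquiv (chartBase x i (x i))
    (fun k => chartGen x i (jJ k).1) jJ (chartQuotEquiv x i hx)
    (fun k => by rw [chartQuotEquiv_apply, chartQuotMap_X])
    (reesChartBase_mem_nonZeroDivisors (x i) (Ideal.mem_span_range_self (f := x) (x := i))) hjJ

/-- Hence the chart family is quasi-regular (Rees, Matsumura Thm. 16.2 (i)).
[cite: Matsumura1987, Thm. 16.2 (i)] -/
theorem CoreRungTower.isQuasiRegular_chartFamily (hx : IsQuasiRegular x)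
    (hjJ : Function.Injective jJ) :
    IsQuasiRegular (Fin.cons (chartBase x i (x i)) fun k => chartGen x i (jJ k).1) :=
  isQuasiRegular_of_isWeaklyRegular _ (CoreRungTower.isWeaklyRegular_chartFamily x i jJ hx hjJ)

/-- **The quotient of the chart ring by the chart family is a regular ring** when `R/M` is:
`B_i/(x_i, e_{jJ}) ≅ (R/M)[T_j : j ≠ i, j ∉ jJ]`, a polynomial ring over a regular ring.
[cite: StacksProject, Tag 0BIQ] -/
theorem CoreRungTower.isRegularRing_quot_chartFamily (hx : IsQuasiRegular x)
    [IsRegularRing (R ⧸ Ideal.span (Set.range x))] :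
    IsRegularRing (chartRing x i ⧸ Ideal.span (Set.range
      (Fin.cons (chartBase x i (x i)) fun k => chartGen x i (jJ k).1))) :=
  CoreRungTower.isRegularRing_quot_cons_of_quotEquiv (chartBase x i (x i))
    (fun k => chartGen x i (jJ k).1) jJ (chartQuotEquiv x i hx)
    (fun k => by rw [chartQuotEquiv_apply, chartQuotMap_X])

end ChartData

/-! ## The tower theorem -/

/-- **Twisting off a Cartier factor**: if every blowing up of `Spec B` along `J` is regular and
`g` is a non-zero-divisor, then every blowing up of `Spec B` along `(g) · J` is regular (it is a
blowing up along `J`, Stacks 080B). [cite: StacksProject, Tag 080B (proof)] -/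
theorem CoreRungTower.isRegular_of_isBlowup_span_singleton_mul {B : Type u} [CommRing B]
    {g : B} (hg : g ∈ nonZeroDivisors B) (J : Ideal B)
    (hJ : ∀ (Y : Scheme.{u}) (ρ : Y ⟶ Spec (.of B)),
      IsBlowup ρ (affineBlowup.idealSheaf J) → Scheme.IsRegular Y)
    {Y : Scheme.{u}} {ρ : Y ⟶ Spec (.of B)}
    (hρ : IsBlowup ρ (affineBlowup.idealSheaf (Ideal.span {g} * J))) : Scheme.IsRegular Y := by
  obtain ⟨Y', ρ', h'⟩ := exists_isBlowup (Spec (.of B)) (affineBlowup.idealSheaf J)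
  have h'' : IsBlowup ρ' (affineBlowup.idealSheaf (Ideal.span {g} * J)) := by
    rw [mul_comm, affineBlowup.idealSheaf_mul]
    exact h'.mul_of_isEffectiveCartier (affineBlowup.isEffectiveCartier_idealSheaf_span_singleton hg)
  obtain ⟨e, -, -⟩ := hρ.unique h''
  exact SectionAscent.TraceIdeal.isRegular_of_iso e (hJ Y' ρ' h')

/-- **THE REGULAR-CENTRE TOWER (ring level).** Let `R` be a regular ring, `x = (x₁, …, x_n)` a
quasi-regular sequence in `R` with `R/(x)` a regular ring, `ι : Fin a ↪ Fin n` a sub-family,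
`P = (x_{ι k})_k ⊆ M = (x)`.  Then for every `N`, every blowing up of `Spec R` along the tower
ideal `∏_{k<N} (P + Mᵏ⁺¹) = M · (P + M²) ⋯ (P + Mᴺ)` is a regular scheme.  Geometrically
(`R` regular local, `x` a regular system of parameters, `L = V(P)`): this blowing up is `Bl_M`
followed by the blowing ups, one after the other, of the regular centres `L_k ∩ E_k`
(`L_k` the strict transform of `L`, `E_k` the newest exceptional divisor), `N` blowing ups in all.
Proof by induction on `N` over the Rees charts of `Bl_M` (chartwise assembly
`isRegular_of_isBlowup_mul_of_charts`): on the chart of a killed direction `x_{ι j}` the tail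
`∏_{k<N} (P + Mᵏ⁺²)` becomes the Cartier divisor `(x_{ι j}ᴺ)`; on any other chart it becomes
`(x_iᴺ) · ∏_{k<N} (P' + M'ᵏ⁺¹)` for the chart family `x' = (x_i, e_{ι 1}, …, e_{ι a})`,
`P' = (e_ι)`, which is again quasi-regular with regular quotient in the regular ring `B_i`.
[cite: Liu2002, Thm. 8.1.19 (a)] [cite: StacksProject, Tag 080A] [cite: StacksProject, Tag 0BIQ] -/
theorem isRegular_of_isBlowup_tower (N : ℕ) :
    ∀ {R : Type u} [CommRing R] [IsRegularRing R] {n a : ℕ} (x : Fin n → R) (ι : Fin a → Fin n),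
      Function.Injective ι → IsQuasiRegular x →
      IsRegularRing (R ⧸ Ideal.span (Set.range x)) →
      ∀ {Y : Scheme.{u}} {f : Y ⟶ Spec (.of R)},
        IsBlowup f (affineBlowup.idealSheaf (∏ k ∈ Finset.range N,
          (Ideal.span (Set.range (x ∘ ι)) ⊔ Ideal.span (Set.range x) ^ (k + 1)))) →
        Scheme.IsRegular Y := by
  induction N with
  | zero =>
    intro R _ _ n a x ι hι hx hR Y f hf
    rw [Finset.prod_range_zero, Ideal.one_eq_top, affineBlowup.idealSheaf_top] at hf
    haveI : IsIso f := hf.isIso isEffectiveCartier_top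
    haveI : IsRegularRing (CommRingCat.of R) := inferInstanceAs (IsRegularRing R)
    exact SectionAscent.TraceIdeal.isRegular_of_iso (asIso f) (Scheme.isRegular_Spec _)
  | succ N ih =>
    intro R _ _ n a x ι hι hx hR Y f hf
    haveI := hR
    have hPM : Ideal.span (Set.range (x ∘ ι)) ≤ Ideal.span (Set.range x) :=
      Ideal.span_mono (Set.range_comp_subset_range ι x)
    rw [prod_range_succ_eq_mul hPM] at hf
    refine isRegular_of_isBlowup_mul_of_charts x _ (fun i Y' ρ hρ => ?_) hf
    haveI hB : IsRegularRing (chartRing x i) := isRegularRing_blowupChart x i hx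
    have hti : chartBase x i (x i) ∈ nonZeroDivisors (chartRing x i) :=
      reesChartBase_mem_nonZeroDivisors (x i) (Ideal.mem_span_range_self (f := x) (x := i))
    rw [CoreRungTower.map_chartBase_prod] at hρ
    refine CoreRungTower.isRegular_of_isBlowup_span_singleton_mul (pow_mem hti N) _
      (fun Y'' ρ' hρ' => ?_) hρ
    by_cases hi : i ∈ Set.range ι
    · -- killed direction: the tail is the unit ideal upstairs
      obtain ⟨j, hij⟩ := hi
      have htop : ∏ k ∈ Finset.range N, (Ideal.span (Set.range fun k => chartGen x i (ι k)) ⊔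
          Ideal.span {chartBase x i (x i) ^ (k + 1)}) = ⊤ := by
        rw [CoreRungTower.span_chartGen_eq_top_of_eq x ι i j hij]
        simp_rw [top_sup_eq]
        rw [Finset.prod_const, ← Ideal.one_eq_top, one_pow]
      rw [htop, affineBlowup.idealSheaf_top] at hρ'
      haveI : IsIso ρ' := hρ'.isIso isEffectiveCartier_top
      haveI : IsRegularRing (CommRingCat.of (chartRing x i)) := hB
      exact SectionAscent.TraceIdeal.isRegular_of_iso (asIso ρ') (Scheme.isRegular_Spec _)
    · -- tangent direction: the same tower one level down for the chart family
      have hne : ∀ k, ι k ≠ i := fun k h => hi ⟨k, h⟩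
      let jJ : Fin a → {j : Fin n // j ≠ i} := fun k => ⟨ι k, hne k⟩
      have hjJ : Function.Injective jJ := fun k k' h => hι (congrArg Subtype.val h)
      let x' : Fin (a + 1) → chartRing x i :=
        Fin.cons (chartBase x i (x i)) fun k => chartGen x i (jJ k).1
      have hx' : IsQuasiRegular x' := CoreRungTower.isQuasiRegular_chartFamily x i jJ hx hjJ
      have hR' : IsRegularRing (chartRing x i ⧸ Ideal.span (Set.range x')) :=
        CoreRungTower.isRegularRing_quot_chartFamily x i jJ hx
      have hP' : Ideal.span (Set.range (x' ∘ Fin.succ)) =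
          Ideal.span (Set.range fun k => chartGen x i (ι k)) := by
        congr 1
      have hM' : Ideal.span (Set.range x') =
          Ideal.span (Set.range (x' ∘ Fin.succ)) ⊔ Ideal.span {chartBase x i (x i)} := by
        rw [hP', show x' = Fin.cons (chartBase x i (x i)) (fun k => chartGen x i (jJ k).1) from rfl,
          Fin.range_cons, Ideal.span_insert, sup_comm]
      have heq : ∏ k ∈ Finset.range N, (Ideal.span (Set.range fun k => chartGen x i (ι k)) ⊔
          Ideal.span {chartBase x i (x i) ^ (k + 1)}) =
          ∏ k ∈ Finset.range N, (Ideal.span (Set.range (x' ∘ Fin.succ)) ⊔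
            Ideal.span (Set.range x') ^ (k + 1)) := by
        refine Finset.prod_congr rfl fun k _ => ?_
        rw [sup_pow_eq_sup_span_singleton_pow hM', hP']
      rw [heq] at hρ'
      exact ih x' Fin.succ (Fin.succ_injective a) hx' hR' hρ'

end Summit.ResolutionOfSingularities.ResolutionOfSingularities.Theorems

end
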